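import Summits.FinalStateConjecture.FinalStateConjecture.Theorems.DissipativeFinalMotionsDispersingCaptureStubHonestRadii
import Summits.FinalStateConjecture.FinalStateConjecture.Theorems.DissipativeFinalMotionsDispersingCaptureStubThinnedFlatChart
import Summits.FinalStateConjecture.FinalStateConjecture.Theorems.DissipativeFinalMotionsDispersingCaptureStubStepData
import Summits.FinalStateConjecture.FinalStateConjecture.Theorems.DissipativeFinalMotionsDispersingCaptureStubZoneHover
import Summits.FinalStateConjecture.FinalStateConjecture.Theorems.DissipativeFinalMotionsDispersingCaptureStubExhaustion
import Literature.Geometry.Lorentzian.FinalEraRestFrameSettling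
import HarnessLib

/-!
# Stub H_core `stub_settledOfNormalised` — THE BRIDGE: a normalised final era settles in its rest frames
# (crux `DispersingCapture`, stmt-FinalStateConjecture-17643, line `registered`, skeleton r11; lead prover c6, 2026-08-17)

Route `DissipativeFinalMotions` of the summit `FinalStateConjecture`. The capture crux `DispersingCapture` (rev 3) was found
under-hypothesised by six leads: the Statement-shaped rest-frame settled data (`CauchyDevelopment.IsRestFrameSettledOn`,
Literature p154854) do not follow from the 31-clause package `IsFinalEra₂` + (R)(F)(F₀) + dispersal. The sixth audit
(`Cruxes/DispersingCapture/Lines/registered-c6.md`) located the whole gap in two primitive chart NORMALISATIONS of the package's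
own charts — (NDF) no deep flat points: a point charted by the flat chart and by hole chart `i` at hole time `> T` has
Kerr–Schild radius `≥ 100 Mᵢ`; (NL) no hole-clock lead on bounded zones: for every radius `R'`, eventually in hole time, a
doubly charted point of hole radius `≤ R'` has hole time `≤` flat time — and this file proves the BRIDGE: granted (NDF) and
(NL), a rev-2 final era which is oriented ((F), (F₀)) and pairwise dispersing SETTLES IN ITS REST FRAMES in the Statement's
shape, `∃ T₁ ρ R U₁ Φ₀, IsRestFrameSettledOn N M a T₁ ξ B Ψ O U₁ Φ₀ ρ R`. With it the option-C restatement of the crux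
(`Cruxes/DispersingCapture/OptionC_c6.lean`, `DispersingCapture₇` = rev 3 + (NDF) + (NL) + escape rates) is PROVED
(`dispersingCapture₇_of_bridge`), and under option A (`IsRestFrameSettledOn` as a hypothesis of both the crux and
`FinalEraGeneric`) it is the lemma that discharges that hypothesis from primitive chart data.

Construction (all pieces landed separately, `--supports` the crux): honest radii `R` and quantitative effacement
(`stub_honestRadii`); levels `ρl ↑ ∞`, step times `t ↑ ∞` and thresholds `τ'` (`stub_stepData`); the two-step thinned flat
domain `U₁ := U₀ ⊓ W`, `W := ⋃ₘ {t m < y⁰ < t (m+2) ∧ ∀ i, ρl m < distᵢ}`, with the restricted flat chart `Φ₀ := Ψ₀|U₁` and the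
restarted hole charts (`stub_thinnedFlatChart`); the certified hover of zone points (`stub_zoneHover`, from the hover leg
`stub_hoverLeg`); the region identity and the exhaustion (`stub_exhaustion`). Here: the tube profile `ρ s := ρl (last step
≤ s)` is sublinear ((S1): `ρ s / s ≤ 1/(m+1)`), the late half-space minus the drifting tubes is inside `U₁` ((S2): the
two-step overlap of `W` and (F2)), the restricted chart is `C²`-flat on WHOLE slabs ((S3): a `U₁`-point of time `≥ t (m+1)`
is `ρl m`-far, so (F3) at tolerance `1/(m+1)` applies, the derivatives of the restricted deviation agreeing) and oriented on
whole slabs ((S7), from (F₀)); (S4)/(S5) are the honest radii; (C0)/(C1), (O1), (S6) are the landed pieces.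

References: Dafermos–Luk arXiv:1710.01722, p. 8 and Conjecture 1; DHRT arXiv:2104.08222, §1; O'Neill 1983, Ch. 14.
-/

set_option linter.dupNamespace false

noncomputable section

open scoped Manifold ContDiff Topology
open Filter Set Function MeasureTheory Literature.Geometry.Lorentzian

namespace Summit.FinalStateConjecture.FinalStateConjecture.Theorems.DissipativeFinalMotions.DispersingCapture

/-- **H_core — THE BRIDGE: a rev-2 final era with (NDF), (NL), (F), (F₀) and pairwise dispersal settles in its rest
frames in the Statement's shape**, `∃ T₁ ρ R U₁ Φ₀, IsRestFrameSettledOn N M a T₁ ξ B Ψ O U₁ Φ₀ ρ R` (see the module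
docstring for the construction). Dafermos–Luk arXiv:1710.01722, Conjecture 1; O'Neill 1983, Ch. 14. -/
theorem stub_settledOfNormalised : open scoped Manifold Topology in ∀ (X : Type) [TopologicalSpace X] [ChartedSpace (EuclideanSpace ℝ (Fin 3)) X] [IsManifold (𝓡 3) ((⊤ : ℕ∞) : WithTop ℕ∞) X] [T2Space X] [SecondCountableTopology X] [ConnectedSpace X], ∀ (D : Literature.Geometry.Lorentzian.InitialDataSet (𝓡 3) X) (𝒟 : Literature.Geometry.Lorentzian.VacuumCauchyDevelopment D) (N : ℕ) (M a : Fin N → ℝ) (T δ V C₁ C₂ ρ₀ κ : ℝ) (ξ : Fin N → ℝ → EuclideanSpace ℝ (Fin 3)) (β : ℝ → ℝ) (U₀ : TopologicalSpace.Opens Literature.Geometry.Lorentzian.E4) (B₀ : Literature.Geometry.Lorentzian.ModelBackground) (B : Fin N → Literature.Geometry.Lorentzian.ModelBackground) (Ψ₀ : B₀.domain → 𝒟.carrier) (Ψ : (i : Fin N) → (B i).domain → 𝒟.carrier) (O : Set 𝒟.carrier), 𝒟.toCauchyDevelopment.IsFinalEra₂ N M a T δ V C₁ C₂ ρ₀ κ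 ξ β U₀ B₀ B Ψ₀ Ψ O → (∀ i (x : (B i).domain) (y : B₀.domain), T < x.1 0 → Ψ i x = Ψ₀ y → 100 * M i ≤ (B i).radius x.1) → (∀ i (R' : ℝ), ∃ T₄ : ℝ, ∀ (x : (B i).domain) (y : B₀.domain), T₄ ≤ x.1 0 → (B i).radius x.1 ≤ R' → Ψ i x = Ψ₀ y → x.1 0 ≤ y.1 0) → (∀ i (ρ : ℝ), ∀ᶠ τ in Filter.atTop, ∀ x ∈ (B i).truncTimeSlab ρ τ, 𝒟.toSpacetime.timeOrientation.IsFutureDirected (mfderiv 𝓘(ℝ, Literature.Geometry.Lorentzian.E4) (𝓡 4) (Ψ i) x (Literature.Geometry.Lorentzian.Kerr.timeVector (M i) (a i) x.1))) → (∃ ϱ₀ : ℝ, ∀ᶠ τ in Filter.atTop, ∀ x ∈ B₀.timeSlab τ, (∀ i, ϱ₀ ≤ ‖Literature.Geometry.Lorentzian.E4.spatial x.1 - ξ i τ‖) → 𝒟.toSpacetime.timeOrientation.IsFutureDirected (mfderiv 𝓘(ℝ, Literature.Geometry.Lorentzian.E4) (𝓡 4) Ψ₀ x (Literature.Geometry.Lorentzian.E4.basisVector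 0))) → (∀ i j, i ≠ j → Filter.Tendsto (fun t ↦ ‖ξ i t - ξ j t‖) Filter.atTop Filter.atTop) → ∃ (T₁ : ℝ) (ρ : ℝ → ℝ) (R : Fin N → ℝ → ℝ) (U₁ : TopologicalSpace.Opens Literature.Geometry.Lorentzian.E4) (Φ₀ : (Literature.Geometry.Lorentzian.Minkowski.backgroundOn U₁).domain → 𝒟.carrier), 𝒟.toCauchyDevelopment.IsRestFrameSettledOn N M a T₁ ξ B Ψ O U₁ Φ₀ ρ R := by
  intro X _ _ _ _ _ _ D 𝒟 N M a T δ V C₁ C₂ ρ₀ κ ξ β U₀ B₀ B Ψ₀ Ψ O hera hndf hnl hholes hflat hdisp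
  -- honest radii and quantitative effacement (H_rad, landed)
  obtain ⟨hq, R, hR1, hR2, hR3⟩ := stub_honestRadii X D 𝒟 N M a T δ V C₁ C₂ ρ₀ κ ξ β U₀ B₀ B Ψ₀ Ψ O hera hdisp
  obtain ⟨h₁, h₂, h₃, h₄, -, -, -, h₈, h₉, h₁₀, -, h₁₂, -, -, -, -, -, h₁₈, h₁₉, h₂₀, h₂₁, -, -, -, -, h₂₆,
    -, h₂₈, h₂₉, -, -⟩ := hera
  subst h₂ h₃
  obtain ⟨ϱ₀, hflat'⟩ := hflat
  have hM : ∀ i, 0 ≤ M i := fun i ↦ (h₄ i).pos.le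
  have hT0 : ∀ m : ℕ, ∀ t : ℕ → ℝ, (∀ m : ℕ, |T| + 1 ≤ t m) → T < t m := fun m t ht ↦
    lt_of_lt_of_le (lt_of_le_of_lt (le_abs_self T) (lt_add_one _)) (ht m)
  -- step data (thresholds of (F3), (F₀), (X3), (X4b), effacement, (F), (NL), radii)
  obtain ⟨t, ρl, τ', ht_mono, ht_ge, ht_T, hρ_mono, hρ_ρ₀, hρ_ge, hρt, hF3', hF0', hloc, hτ'T, hq', hF',
      hnl', hRτ'⟩ :=
    stub_stepData X D 𝒟 N M a T C₁ C₂ ρ₀ ϱ₀ ξ U₀ Ψ₀ Ψ R h₂₀ hflat' h₂₆ h₂₈ hq hholes hnl fun i ↦ (hR1 i).1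
  have hTt : ∀ m : ℕ, T < t m := fun m ↦ hT0 m t ht_T
  -- the thinned flat domain `U₀ ⊓ W`, `W` = two-step windows beyond the levels `ρl`
  have hc0 : Continuous fun y : E4 ↦ y 0 := (EuclideanSpace.proj (0 : Fin 4)).continuous
  have hdist : ∀ i, Continuous fun y : E4 ↦ ‖E4.spatial y - ξ i (y 0)‖ := fun i ↦
    (E4.spatial.continuous.sub ((h₁₂ i).continuous.comp hc0)).norm
  set Wset : Set E4 := ⋃ m : ℕ, {y : E4 | t m < y 0 ∧ y 0 < t (m + 2) ∧
    ∀ i, ρl m < ‖E4.spatial y - ξ i (y 0)‖} with hWset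
  have hWopen : IsOpen Wset := by
    refine isOpen_iUnion fun m ↦ ?_
    have h3 : IsOpen {y : E4 | ∀ i, ρl m < ‖E4.spatial y - ξ i (y 0)‖} := by
      simp only [setOf_forall]
      exact isOpen_iInter_of_finite fun i ↦ isOpen_lt continuous_const (hdist i)
    simp only [setOf_and]
    exact (isOpen_lt continuous_const hc0).inter ((isOpen_lt hc0 continuous_const).inter h3)
  set W : TopologicalSpace.Opens E4 := ⟨Wset, hWopen⟩ with hW
  have hW1 : ∀ y : E4, y ∈ W → ∃ m : ℕ, t m < y 0 ∧ y 0 < t (m + 2) ∧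
      ∀ i, ρl m < ‖E4.spatial y - ξ i (y 0)‖ := fun y hy ↦ by
    simpa only [hW, hWset, TopologicalSpace.Opens.mem_mk, mem_iUnion, mem_setOf_eq] using hy
  have hW2 : ∀ (y : E4) (m : ℕ), t m < y 0 → y 0 < t (m + 2) →
      (∀ i, ρl m < ‖E4.spatial y - ξ i (y 0)‖) → y ∈ W := fun y m h1 h2 h3 ↦ by
    simp only [hW, hWset, TopologicalSpace.Opens.mem_mk, mem_iUnion, mem_setOf_eq]
    exact ⟨m, h1, h2, h3⟩
  -- restart and restriction of the charts (H_thin, landed)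
  obtain ⟨hrestart, hthin⟩ := stub_thinnedFlatChart X D 𝒟 O T (t 0) (hTt 0).le
  obtain ⟨Φ₀, hΦval, hΦlate, hΦmf, hΦdev⟩ := hthin U₀ W Ψ₀ h₁₈
  -- the certified hover (zoneHover + step data)
  have hHov : ∀ (m : ℕ) (i : Fin N) (x : (Kerr.background (M i) (a i)).domain) (τ₁ : ℝ), τ' m < x.1 0 →
      x.1 0 ≤ τ₁ → 100 * M i ≤ Kerr.radius (a i) x.1 → Kerr.radius (a i) x.1 ≤ C₂ * ρl m + C₁ →
      Ψ i x ∈ 𝒟.toSpacetime.metric.causalPast 𝒟.toSpacetime.timeOrientation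
        (Ψ i '' (Kerr.background (M i) (a i)).truncTimeSlab (R i τ₁) τ₁) := by
    intro m i x τ₁ h1 h2 h3 h4
    exact stub_zoneHover X D 𝒟 (M i) (a i) (Ψ i) x (C₂ * ρl m + C₁) (R i τ₁) (τ' m) τ₁ (hM i) (h₂₁ i).contMDiff h3
      h4 (hRτ' m i τ₁ (h1.le.trans h2)) h1.le h2 (fun τ hτ ↦ hq' m i τ hτ)
      (hF' m i (x.1 0) h1.le x ⟨rfl, h4⟩)
  -- region identity and exhaustion (lead's stub)
  obtain ⟨hO1, hS6⟩ := stub_exhaustion X D 𝒟 N M a T C₁ C₂ ρ₀ ξ U₀ W Ψ₀ Ψ O R t ρl τ' Φ₀ h₁ h₁₈ h₂₁ h₂₉ hR2 ht_mono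
    ht_ge hTt hτ'T hloc hnl' hRτ' hndf hHov hW1 hW2 hΦval
  -- the index of the last step `≤ s` and the tube profile `ρ s := ρl (idx s)`
  classical
  set idx : ℝ → ℕ := fun s ↦ Nat.findGreatest (fun m ↦ t m ≤ s) ⌈s⌉₊ with hidx
  have hidx_ge : ∀ (m : ℕ) (s : ℝ), t m ≤ s → m ≤ idx s := by
    intro m s hs
    have hm : m ≤ ⌈s⌉₊ := Nat.cast_le.1 (((ht_ge m).trans hs).trans (Nat.le_ceil s))
    exact Nat.le_findGreatest hm hs
  have hidx_spec : ∀ s : ℝ, t 0 ≤ s → t (idx s) ≤ s := fun s hs ↦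
    Nat.findGreatest_spec (P := fun m ↦ t m ≤ s) (Nat.zero_le _) hs
  have hidx_lt : ∀ s : ℝ, s < t (idx s + 1) := by
    intro s
    by_contra h
    push Not at h
    exact Nat.lt_irrefl _ (Nat.lt_of_succ_le (hidx_ge _ s h))
  have hidx_tendsto : Tendsto idx atTop atTop :=
    tendsto_atTop_atTop.2 fun m ↦ ⟨t m, fun s hs ↦ hidx_ge m s hs⟩
  set ρ : ℝ → ℝ := fun s ↦ ρl (idx s) with hρ
  have ht_pos : ∀ m : ℕ, 0 < t m := fun m ↦
    lt_of_lt_of_le (by positivity : (0 : ℝ) < |T| + 1) (ht_T m)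
  have hρl_nonneg : ∀ m : ℕ, 0 ≤ ρl m := fun m ↦ le_trans (by positivity) (hρ_ge m)
  refine ⟨t 0, ρ, R, U₀ ⊓ W, Φ₀, hΦlate, fun i ↦ hrestart _ _ hc0 (h₂₁ i), ?_, ?_, ?_, hR1, hR3, hO1, hS6, ?_⟩
  · -- (S1) sublinear profile: `ρ s / s ≤ 1 / (idx s + 1) → 0`
    have hb : Tendsto (fun s : ℝ ↦ 1 / ((idx s : ℝ) + 1)) atTop (𝓝 0) := by
      have h1 : Tendsto (fun s : ℝ ↦ (idx s : ℝ) + 1) atTop atTop :=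
        tendsto_atTop_add_const_right _ _ (tendsto_natCast_atTop_atTop.comp hidx_tendsto)
      have h2 := tendsto_inv_atTop_zero.comp h1
      simpa only [one_div, Function.comp_def] using h2
    refine tendsto_of_tendsto_of_tendsto_of_le_of_le' tendsto_const_nhds hb ?_ ?_
    · filter_upwards [eventually_ge_atTop (t 0)] with s hs
      exact div_nonneg (hρl_nonneg _) ((ht_pos 0).le.trans hs)
    · filter_upwards [eventually_ge_atTop (t 0)] with s hs
      have hs0 : 0 < s := (ht_pos 0).trans_le hs
      have hk : ((idx s : ℝ) + 1) * ρl (idx s) ≤ t (idx s) := hρt (idx s)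
      have hts : t (idx s) ≤ s := hidx_spec s hs
      rw [div_le_div_iff₀ hs0 (by positivity), one_mul]
      calc ρ s * ((idx s : ℝ) + 1) = ((idx s : ℝ) + 1) * ρl (idx s) := by rw [hρ, mul_comm]
        _ ≤ s := hk.trans hts
  · -- (S2) the late half-space minus the drifting tubes is inside `U₀ ⊓ W`
    rintro y ⟨hy0, hyfar⟩
    refine ⟨h₁₉ ⟨(hTt 0).trans hy0, fun i ↦ (hρ_ρ₀ _).trans_lt (hyfar i)⟩, ?_⟩
    have hk1 : t (idx (y 0)) ≤ y 0 := hidx_spec _ hy0.le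
    have hk2 : y 0 < t (idx (y 0) + 1) := hidx_lt _
    rcases hk1.lt_or_eq with hlt | heq
    · exact hW2 y (idx (y 0)) hlt (hk2.trans (ht_mono (by omega))) hyfar
    · -- `y 0` is exactly a step time `t k`, `k ≥ 1`: use the previous window
      obtain ⟨k, hk⟩ : ∃ k : ℕ, idx (y 0) = k + 1 := by
        refine Nat.exists_eq_add_one.2 (Nat.pos_of_ne_zero fun h0 ↦ ?_)
        rw [h0] at heq
        exact absurd heq (ne_of_gt hy0).symm
      refine hW2 y k ?_ ?_ fun i ↦ lt_of_le_of_lt (hρ_mono (Nat.le_succ k)) ?_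
      · calc t k < t (k + 1) := ht_mono (Nat.lt_succ_self k)
          _ = y 0 := by rw [← hk]; exact heq
      · calc y 0 < t (idx (y 0) + 1) := hk2
          _ = t (k + 2) := by rw [hk]
      · simpa only [hρ, hk] using hyfar i
  · -- (S3) full-slab `C²` flatness of the restricted chart: level `m` bounds every slab after `t (m + 1)`
    rw [ENNReal.tendsto_nhds_zero]
    intro ε hε
    obtain ⟨r, hr0, hrε⟩ : ∃ r : ℝ, 0 < r ∧ ENNReal.ofReal r ≤ ε := by
      rcases eq_or_ne ε ⊤ with h | h
      · exact ⟨1, one_pos, h ▸ le_top⟩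
      · refine ⟨ε.toReal, ENNReal.toReal_pos hε.ne' h, (ENNReal.ofReal_toReal h).le⟩
    obtain ⟨m, hm⟩ := exists_nat_one_div_lt hr0
    filter_upwards [eventually_ge_atTop (t (m + 1))] with τ hτ
    refine le_trans ?_ ((ENNReal.ofReal_le_ofReal hm.le).trans hrε)
    refine le_trans ?_ (hF3' m τ ((ht_mono (Nat.lt_succ_self m)).le.trans hτ))
    -- compare the two sup norms pointwise
    refine iSup₂_le fun k hk ↦ iSup₂_le fun z hz ↦ ?_
    obtain ⟨y, hy, rfl⟩ := hz
    have hyτ : y.1 0 = τ := hy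
    obtain ⟨n, hn1, hn2, hn3⟩ := hW1 y.1 y.2.2
    have hnm : m ≤ n := by
      have : t (m + 1) < t (n + 2) := lt_of_le_of_lt hτ (hyτ ▸ hn2)
      have := (ht_mono.lt_iff_lt).1 this
      omega
    rw [hΦdev k y]
    have hmem : y.1 ∈ Subtype.val '' {y' : (Minkowski.backgroundOn U₀).domain | y'.1 0 = τ ∧
        ∀ i, ρl m ≤ ‖E4.spatial y'.1 - ξ i τ‖} :=
      ⟨⟨y.1, y.2.1⟩, ⟨hyτ, fun i ↦ ((hρ_mono hnm).trans (hn3 i).le).trans_eq (by rw [hyτ])⟩, rfl⟩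
    exact enorm_iteratedFDeriv_le_supCkENorm hk hmem _
  · -- (S7) orientation of the restricted flat chart on whole flat slabs
    refine Filter.Eventually.of_forall fun τ y hy ↦ ?_
    have hyτ : y.1 0 = τ := hy
    obtain ⟨n, hn1, -, hn3⟩ := hW1 y.1 y.2.2
    have hfd := hF0' n τ (hyτ ▸ hn1.le) ⟨y.1, y.2.1⟩ hy fun i ↦ (hn3 i).le.trans_eq (by rw [hyτ])
    have key : ∀ p : 𝒟.carrier, p = Ψ₀ ⟨y.1, y.2.1⟩ → ∀ w : E4,
        𝒟.toSpacetime.timeOrientation.IsFutureDirected (x := Ψ₀ ⟨y.1, y.2.1⟩) w →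
          𝒟.toSpacetime.timeOrientation.IsFutureDirected (x := p) w := by
      rintro p rfl w hw
      exact hw
    rw [hΦmf]
    exact key (Φ₀ y) (hΦval y) _ hfd

end Summit.FinalStateConjecture.FinalStateConjecture.Theorems.DissipativeFinalMotions.DispersingCapture

end
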